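import Literature.NumberTheory.Automorphic.HeckeFamilyTraceMultiplicity
import Literature.NumberTheory.EllipticCurves.MurtySinhaMultiplicityHeckeProofs
import Literature.NumberTheory.EllipticCurves.HeckeOperatorsDoubleCoset
import Literature.NumberTheory.EllipticCurves.HeckeOperatorsDiamondCommProofs
import Literature.NumberTheory.EllipticCurves.HeckeOperatorsDiamondProofs
import HarnessLib

/-!
# The Hecke operators `T_n`, `(n, N) = 1`, on `S_k(Γ₀(N))` form a semisimple commuting Hecke
# family whose traces are the left-hand side of the Eichler–Selberg trace formula

Topic `Literature/NumberTheory/EllipticCurves` (the tree's cusp forms and Hecke operators);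
theorems and definitions with bodies only (no named fact). The modular side of Eichler's basis
theorem in Pizer's Hecke-module form (A. Pizer, J. Algebra 64 (1980), Thm. 2.28, whose proof
compares `tr T(n)` on `S_k(Γ₀(N))` with traces of Brandt matrices): we transport the tree's
`T_n = heckeTn N k n` on `S_k(Γ₁(N))` (`HeckeTraceFormulaGL2Level.lean`, Diamond–Shurman §5.3) to
`S_k(Γ₀(N)) ≅ S_k(N, 𝟙)` and check the hypotheses of the abstract engine
`HeckeFamilyTraceMultiplicity.lean`.

* `heckeTn_mul_of_coprime` — **`T_{mn} = T_m T_n` for coprime `m, n` on `S_k(Γ₁(N))`**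
  (Diamond–Shurman §5.3, (5.10); by definition `T_n = ∏ T_{p^e}` over the sorted prime
  factorisation, and all `T_{p^e}` commute pairwise since the generators `T_p`, `⟨d⟩` do:
  `heckeT_comm_holds`, `heckeT_diamondOp_comm_holds`, `diamondOp_mul_holds`).
* `gamma0EquivNebentypus N k : S_k(Γ₀(N)) ≃ S_k(N, 𝟙)` (the lift `liftToGamma1`, an isomorphism
  onto the `𝟙`-eigenspace of the diamond operators: Diamond–Shurman §4.3, §5.2) and the
  `T_n`-stability of `S_k(N, 𝟙)` (`heckeTn_mem_nebentypusSubspace_one`).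
* `heckeTnGamma0 N k n` — **`T_n` on `S_k(Γ₀(N))`**, the transport of `T_n | S_k(N, 𝟙)`;
  `liftToGamma1_heckeTnGamma0` (`lift ∘ T_n = T_n ∘ lift`), `heckeTnGamma0_prime`
  (`= heckeT (Gamma0 N) k p`, Diamond–Shurman Ex. 5.2.4), `heckeTnGamma0_one`,
  `heckeTnGamma0_mul_of_coprime`, `heckeTnGamma0_prime_pow`
  (`T_{p^{a+2}} = T_p T_{p^{a+1}} - p^{k-1} T_{p^a}` for `p ∤ N`, `⟨p⟩ = 1` on `S_k(N, 𝟙)`),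
  `trace_heckeTnGamma0` (**`tr (T_n | S_k(Γ₀(N))) = cuspidalHeckeTrace N k 𝟙 n`**, the
  left-hand side of the named fact `HeckeTraceFormulaGL2Level N 1 k`).
* `isHeckeFamily_heckeTnGamma0`, `isSemisimpleFamily_heckeTnGamma0` — a semisimple commuting
  Hecke family away from `N` with constants `c(p) = p^{k-1}` (commutation
  `heckeT_comm_gamma0_holds`; diagonalisability from Petersson self-adjointness,
  `heckeT_selfAdjoint_holds` and `maxGenEigenspace_eq_eigenspace_of_selfAdjoint`, as in
  `MurtySinha.heckeT_gamma0_spectralData`); `mem_eigenChar_heckeTnGamma0_iff` — its simultaneous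
  eigenspaces are the `T_p`-eigenpackets `{f : T_p f = χ(p) f, p ∤ N}`.

## References

* [DiamondShurman2005] F. Diamond, J. Shurman, GTM 228, §4.3, §5.2 (Prop. 5.2.4, Ex. 5.2.4),
  §5.3 ((5.10), definition of `T_n`), Thm. 5.5.4.
* [Pizer1980] A. Pizer, J. Algebra 64 (1980), Thm. 2.25, Thm. 2.28.
-/

noncomputable section

open scoped MatrixGroups ModularForm ComplexConjugate

open CongruenceSubgroup Module Module.End

namespace Literature.NumberTheory.EllipticCurves.ModularForms

open Literature.NumberTheory.Automorphic
open Literature.NumberTheory.Automorphic.HeckeTraceFormulaGL2Level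

variable (N : ℕ) [NeZero N] (k : ℤ)

/-! ### Commutation of the `T_{p^e}` and coprime multiplicativity of `T_n` on `S_k(Γ₁(N))` -/

section Gamma1

/-- `⟨d⟩` (or `0`) commutes with `T_p` (Diamond–Shurman Prop. 5.2.4). [cite: DiamondShurman2005, Prop. 5.2.4] -/
theorem commute_diamondOrZero_heckeT (d p : ℕ) [NeZero p] :
    Commute (diamondOrZero N k d) (heckeT (Gamma1 N) k p) := by
  unfold diamondOrZero
  split_ifs with h
  · exact (heckeT_diamondOp_comm_holds N k p (d : ZMod N)).symm
  · exact Commute.zero_left _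

/-- `⟨d⟩` and `⟨e⟩` (or `0`) commute (`⟨d⟩⟨e⟩ = ⟨de⟩`, Diamond–Shurman §5.2). [cite: DiamondShurman2005, §5.2] -/
theorem commute_diamondOrZero (d e : ℕ) : Commute (diamondOrZero N k d) (diamondOrZero N k e) := by
  unfold diamondOrZero
  split_ifs with hd he he'
  · have hd' : IsUnit ((d : ℕ) : ZMod N) := (ZMod.isUnit_iff_coprime d N).mpr hd
    have he' : IsUnit ((e : ℕ) : ZMod N) := (ZMod.isUnit_iff_coprime e N).mpr he
    change diamondOp N k (d : ZMod N) * diamondOp N k (e : ZMod N) =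
      diamondOp N k (e : ZMod N) * diamondOp N k (d : ZMod N)
    rw [← diamondOp_mul_holds N k hd' he', ← diamondOp_mul_holds N k he' hd', mul_comm]
  · exact Commute.zero_right _
  · exact Commute.zero_left _
  · exact Commute.zero_left _

/-- Anything commuting with `T_p` and `⟨p⟩` commutes with every `T_{p^m}` (induction on the
recursion `T_{p^{m+2}} = T_p T_{p^{m+1}} - p^{k-1} ⟨p⟩ T_{p^m}`). [cite: DiamondShurman2005, §5.3 (definition of T_{p^r})] -/
theorem commute_heckeTPrimePow_of_commute {X : Module.End ℂ (CuspForm (Gamma1 N) k)} (p : ℕ)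
    [NeZero p] (hT : Commute X (heckeT (Gamma1 N) k p)) (hD : Commute X (diamondOrZero N k p))
    (m : ℕ) : Commute X (heckeTPrimePow N k p m) := by
  have key : ∀ m, Commute X (heckeTPrimePow N k p m) ∧ Commute X (heckeTPrimePow N k p (m + 1)) := by
    intro m
    induction m with
    | zero =>
      exact ⟨Commute.one_right X, by simpa [heckeTPrimePow] using hT⟩
    | succ m ih =>
      refine ⟨ih.2, ?_⟩
      rw [MurtySinha.heckeTPrimePow_add_two]
      have h2 : Commute X (diamondOrZero N k p * heckeTPrimePow N k p m) := hD.mul_right ih.1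
      refine Commute.sub_right (hT.mul_right ih.2) ?_
      change X * ((p : ℂ) ^ (k - 1) • (diamondOrZero N k p * heckeTPrimePow N k p m)) =
        ((p : ℂ) ^ (k - 1) • (diamondOrZero N k p * heckeTPrimePow N k p m)) * X
      rw [mul_smul_comm, smul_mul_assoc, h2.eq]
  exact (key m).1

/-- `T_{p^a}` and `T_{q^b}` commute, for all `p, q ≥ 1`. [cite: DiamondShurman2005, Prop. 5.2.4] -/
theorem commute_heckeTPrimePow (p q : ℕ) [NeZero p] [NeZero q] (a b : ℕ) :
    Commute (heckeTPrimePow N k p a) (heckeTPrimePow N k q b) := by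
  have hTT : Commute (heckeT (Gamma1 N) k q) (heckeT (Gamma1 N) k p) := heckeT_comm_holds N k q p
  have h1 : Commute (heckeT (Gamma1 N) k q) (heckeTPrimePow N k p a) :=
    commute_heckeTPrimePow_of_commute N k (X := heckeT (Gamma1 N) k q) p hTT
      (commute_diamondOrZero_heckeT N k p q).symm a
  have h2 : Commute (diamondOrZero N k q) (heckeTPrimePow N k p a) :=
    commute_heckeTPrimePow_of_commute N k (X := diamondOrZero N k q) p
      (commute_diamondOrZero_heckeT N k q p) (commute_diamondOrZero N k q p) a
  exact commute_heckeTPrimePow_of_commute N k (X := heckeTPrimePow N k p a) q h1.symm h2.symm b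

/-- The factor of `T_n` at the prime `p`: `T_{p^{v_p(n)}}` (and `1` at the junk index `p = 0`);
literally the factor in the definition of `heckeTn`. [cite: DiamondShurman2005, §5.3 (definition of T_n)] -/
def heckeTnFactor (n p : ℕ) : Module.End ℂ (CuspForm (Gamma1 N) k) :=
  if h : p = 0 then (1 : Module.End ℂ (CuspForm (Gamma1 N) k))
  else
    haveI : NeZero p := ⟨h⟩
    heckeTPrimePow N k p (n.factorization p)

/-- `T_n` is the product of its factors over the sorted prime factors (definitional). [cite: DiamondShurman2005, §5.3 (definition of T_n)] -/
theorem heckeTn_eq_prod_map (n : ℕ) :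
    heckeTn N k n = ((n.primeFactors.sort (· ≤ ·)).map (heckeTnFactor N k n)).prod :=
  rfl

/-- The factors of `T_n` commute pairwise. [cite: DiamondShurman2005, Prop. 5.2.4] -/
theorem commute_heckeTnFactor (m n p q : ℕ) :
    Commute (heckeTnFactor N k m p) (heckeTnFactor N k n q) := by
  unfold heckeTnFactor
  split_ifs with hp hq hq
  · exact Commute.one_right _
  · exact Commute.one_left _
  · exact Commute.one_right _
  · haveI : NeZero p := ⟨hp⟩
    haveI : NeZero q := ⟨hq⟩
    exact commute_heckeTPrimePow N k p q _ _

/-- `T_n` as a `noncommProd` over the prime factors of `n`. [cite: DiamondShurman2005, §5.3 (definition of T_n)] -/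
theorem heckeTn_eq_noncommProd (n : ℕ) :
    heckeTn N k n = n.primeFactors.noncommProd (heckeTnFactor N k n)
      (fun p _ q _ _ => commute_heckeTnFactor N k n n p q) := by
  rw [heckeTn_eq_prod_map, ← Finset.noncommProd_toFinset _ (heckeTnFactor N k n)
    (fun p _ q _ _ => commute_heckeTnFactor N k n n p q) (Finset.sort_nodup _ _)]
  exact Finset.noncommProd_congr (Finset.sort_toFinset _ _) (fun _ _ => rfl) _

/-- **`T_{mn} = T_m T_n` on `S_k(Γ₁(N))` for coprime `m, n ≥ 1`** (Diamond–Shurman §5.3 (5.10)).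
[cite: DiamondShurman2005, §5.3 (5.10)] -/
theorem heckeTn_mul_of_coprime {m n : ℕ} (hm : m ≠ 0) (hn : n ≠ 0) (hmn : m.Coprime n) :
    heckeTn N k (m * n) = heckeTn N k m * heckeTn N k n := by
  classical
  rw [heckeTn_eq_noncommProd, heckeTn_eq_noncommProd, heckeTn_eq_noncommProd]
  rw [Finset.noncommProd_congr (Nat.Coprime.primeFactors_mul hmn) (fun _ _ => rfl),
    Finset.noncommProd_union_of_disjoint (Nat.Coprime.disjoint_primeFactors hmn)]
  have hfac : (m * n).factorization = m.factorization + n.factorization := Nat.factorization_mul hm hn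
  congr 1
  · refine Finset.noncommProd_congr rfl (fun p hp => ?_) _
    have hp' : p.Prime := Nat.prime_of_mem_primeFactors hp
    have hpn : ¬ p ∣ n := fun h => by
      have : p ∣ Nat.gcd m n := Nat.dvd_gcd (Nat.dvd_of_mem_primeFactors hp) h
      rw [hmn] at this
      exact hp'.one_lt.ne' (Nat.dvd_one.mp this)
    simp only [heckeTnFactor, hfac, Finsupp.add_apply, Nat.factorization_eq_zero_of_not_dvd hpn, add_zero]
  · refine Finset.noncommProd_congr rfl (fun p hp => ?_) _
    have hp' : p.Prime := Nat.prime_of_mem_primeFactors hp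
    have hpm : ¬ p ∣ m := fun h => by
      have : p ∣ Nat.gcd m n := Nat.dvd_gcd h (Nat.dvd_of_mem_primeFactors hp)
      rw [hmn] at this
      exact hp'.one_lt.ne' (Nat.dvd_one.mp this)
    simp only [heckeTnFactor, hfac, Finsupp.add_apply, Nat.factorization_eq_zero_of_not_dvd hpm, zero_add]

end Gamma1

/-! ### `S_k(Γ₀(N)) ≅ S_k(N, 𝟙)` and the stability of `S_k(N, 𝟙)` under `T_n` -/

section Transport

/-- `T_p` (any `p ≥ 1`) preserves `S_k(N, 𝟙)` (it commutes with the lift from `Γ₀(N)`,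
`heckeT_liftToGamma1`). [cite: DiamondShurman2005, Exercise 5.2.4] -/
theorem heckeT_mem_nebentypusSubspace_one (p : ℕ) [NeZero p] {w : CuspForm (Gamma1 N) k}
    (hw : w ∈ nebentypusSubspace N k 1) : heckeT (Gamma1 N) k p w ∈ nebentypusSubspace N k 1 := by
  obtain ⟨v, rfl⟩ := MurtySinha.exists_liftToGamma1_eq_of_mem_nebentypusSubspace_one N k hw
  rw [heckeT_liftToGamma1 N k p v]
  exact MurtySinha.liftToGamma1_mem_nebentypusSubspace_one N k _

/-- `⟨d⟩` is the identity on `S_k(N, 𝟙)` for `d` prime to `N`, and `diamondOrZero` is `0`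
otherwise; in both cases it preserves `S_k(N, 𝟙)`. [cite: DiamondShurman2005, §5.2 p. 169] -/
theorem diamondOrZero_apply_of_mem (d : ℕ) {w : CuspForm (Gamma1 N) k}
    (hw : w ∈ nebentypusSubspace N k 1) :
    diamondOrZero N k d w = if d.Coprime N then w else 0 := by
  unfold diamondOrZero
  split_ifs with h
  · have := (MurtySinha.mem_nebentypusSubspace_one_iff N k w).mp hw (ZMod.unitOfCoprime d h)
    rwa [ZMod.coe_unitOfCoprime] at this
  · rfl

/-- `diamondOrZero N k d` preserves `S_k(N, 𝟙)`. [cite: DiamondShurman2005, §5.2 p. 169] -/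
theorem diamondOrZero_mem_nebentypusSubspace_one (d : ℕ) {w : CuspForm (Gamma1 N) k}
    (hw : w ∈ nebentypusSubspace N k 1) : diamondOrZero N k d w ∈ nebentypusSubspace N k 1 := by
  rw [diamondOrZero_apply_of_mem N k d hw]
  split_ifs
  · exact hw
  · exact Submodule.zero_mem _

/-- `T_{p^m}` preserves `S_k(N, 𝟙)`. [cite: DiamondShurman2005, §5.3 (definition of T_{p^r})] -/
theorem heckeTPrimePow_mem_nebentypusSubspace_one (p : ℕ) [NeZero p] (m : ℕ) :
    ∀ {w : CuspForm (Gamma1 N) k}, w ∈ nebentypusSubspace N k 1 →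
      heckeTPrimePow N k p m w ∈ nebentypusSubspace N k 1 := by
  have key : ∀ m, (∀ w ∈ nebentypusSubspace N k 1, heckeTPrimePow N k p m w ∈ nebentypusSubspace N k 1) ∧
      (∀ w ∈ nebentypusSubspace N k 1, heckeTPrimePow N k p (m + 1) w ∈ nebentypusSubspace N k 1) := by
    intro m
    induction m with
    | zero =>
      exact ⟨fun w hw => by simpa [heckeTPrimePow] using hw,
        fun w hw => by simpa [heckeTPrimePow] using heckeT_mem_nebentypusSubspace_one N k p hw⟩
    | succ m ih =>
      refine ⟨ih.2, fun w hw => ?_⟩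
      rw [MurtySinha.heckeTPrimePow_add_two, LinearMap.sub_apply, LinearMap.smul_apply,
        Module.End.mul_apply, Module.End.mul_apply]
      exact Submodule.sub_mem _ (heckeT_mem_nebentypusSubspace_one N k p (ih.2 w hw))
        (Submodule.smul_mem _ _ (diamondOrZero_mem_nebentypusSubspace_one N k p (ih.1 w hw)))
  intro w hw
  exact (key m).1 w hw

/-- A product of a list of endomorphisms each preserving a submodule preserves it. [folklore] -/
theorem list_prod_apply_mem {V : Type*} [AddCommGroup V] [Module ℂ V] (W : Submodule ℂ V)
    (L : List (Module.End ℂ V)) (hL : ∀ f ∈ L, ∀ w ∈ W, f w ∈ W) :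
    ∀ w ∈ W, L.prod w ∈ W := by
  induction L with
  | nil => intro w hw; simpa using hw
  | cons f L ih =>
    intro w hw
    rw [List.prod_cons, Module.End.mul_apply]
    exact hL f (by simp) _ (ih (fun g hg => hL g (by simp [hg])) w hw)

/-- **`T_n` preserves `S_k(N, 𝟙)`** for every `n`. [cite: DiamondShurman2005, Prop. 5.2.4] -/
theorem heckeTn_mem_nebentypusSubspace_one (n : ℕ) :
    ∀ w ∈ nebentypusSubspace N k 1, heckeTn N k n w ∈ nebentypusSubspace N k 1 := by
  rw [heckeTn_eq_prod_map]
  refine list_prod_apply_mem _ _ fun f hf w hw => ?_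
  obtain ⟨p, -, rfl⟩ := List.mem_map.mp hf
  unfold heckeTnFactor
  split_ifs with hp
  · simpa using hw
  · haveI : NeZero p := ⟨hp⟩
    exact heckeTPrimePow_mem_nebentypusSubspace_one N k p _ hw

/-- **`S_k(Γ₀(N)) ≅ S_k(N, 𝟙)`**: the lift `liftToGamma1` is an isomorphism onto the
`𝟙`-eigenspace of the diamond operators (Diamond–Shurman §4.3 p. 119 and §5.2;
`liftToGamma1_injective`, `exists_liftToGamma1_eq_of_forall_diamondOp_eq`). [cite: DiamondShurman2005, §4.3 p. 119] -/
def gamma0EquivNebentypus : CuspForm (Gamma0 N) k ≃ₗ[ℂ] nebentypusSubspace N k 1 :=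
  LinearEquiv.ofBijective
    (LinearMap.codRestrict (nebentypusSubspace N k 1) (liftToGamma1 N k)
      (MurtySinha.liftToGamma1_mem_nebentypusSubspace_one N k))
    ⟨fun a b h => liftToGamma1_injective N k (by
        have := congrArg (Subtype.val : nebentypusSubspace N k 1 → CuspForm (Gamma1 N) k) h
        simpa using this),
      fun ⟨w, hw⟩ => by
        obtain ⟨v, rfl⟩ := MurtySinha.exists_liftToGamma1_eq_of_mem_nebentypusSubspace_one N k hw
        exact ⟨v, rfl⟩⟩

/-- The isomorphism is the lift on underlying forms. [folklore] -/
@[simp] theorem coe_gamma0EquivNebentypus (f : CuspForm (Gamma0 N) k) :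
    ((gamma0EquivNebentypus N k f : nebentypusSubspace N k 1) : CuspForm (Gamma1 N) k) =
      liftToGamma1 N k f :=
  rfl

/-- **`T_n` on `S_k(Γ₀(N))`** (`n : ℕ`): the transport of `T_n | S_k(N, 𝟙)` (`heckeTn`, the
operator whose trace is the left-hand side `cuspidalHeckeTrace N k 𝟙 n` of the Eichler–Selberg
trace formula) through `S_k(Γ₀(N)) ≅ S_k(N, 𝟙)`. For `n = p` prime this is the double coset
operator `heckeT (Gamma0 N) k p` (`heckeTnGamma0_prime`). [cite: DiamondShurman2005, §5.3 (definition of T_n)] -/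
def heckeTnGamma0 (n : ℕ) : Module.End ℂ (CuspForm (Gamma0 N) k) :=
  (gamma0EquivNebentypus N k).symm.conj
    ((heckeTn N k n).restrict (heckeTn_mem_nebentypusSubspace_one N k n))

/-- **`lift ∘ T_n = T_n ∘ lift`**: the defining property of `heckeTnGamma0`. [cite: DiamondShurman2005, Exercise 5.2.4] -/
theorem liftToGamma1_heckeTnGamma0 (n : ℕ) (f : CuspForm (Gamma0 N) k) :
    liftToGamma1 N k (heckeTnGamma0 N k n f) = heckeTn N k n (liftToGamma1 N k f) := by
  have h : heckeTnGamma0 N k n f = (gamma0EquivNebentypus N k).symm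
      (((heckeTn N k n).restrict (heckeTn_mem_nebentypusSubspace_one N k n))
        (gamma0EquivNebentypus N k f)) := by
    rw [heckeTnGamma0, LinearEquiv.conj_apply_apply, LinearEquiv.symm_symm]
  have h' := congrArg (fun g => ((gamma0EquivNebentypus N k g : nebentypusSubspace N k 1) :
    CuspForm (Gamma1 N) k)) h
  simp only [LinearEquiv.apply_symm_apply, coe_gamma0EquivNebentypus] at h'
  rw [h']
  rfl

/-- **`T_p` on `S_k(Γ₀(N))` is the double coset operator `[Γ₀(N) diag(1,p) Γ₀(N)]`**
(`heckeT_liftToGamma1`, Diamond–Shurman Ex. 5.2.4). [cite: DiamondShurman2005, Exercise 5.2.4] -/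
theorem heckeTnGamma0_prime (p : ℕ) [NeZero p] (hp : p.Prime) :
    heckeTnGamma0 N k p = heckeT (Gamma0 N) k p := by
  apply LinearMap.ext
  intro f
  apply liftToGamma1_injective N k
  rw [liftToGamma1_heckeTnGamma0, heckeTn_prime N k p hp, heckeT_liftToGamma1]

/-- `T_1 = 1` on `S_k(Γ₀(N))`. [cite: DiamondShurman2005, §5.3] -/
theorem heckeTnGamma0_one : heckeTnGamma0 N k 1 = 1 := by
  apply LinearMap.ext
  intro f
  apply liftToGamma1_injective N k
  rw [liftToGamma1_heckeTnGamma0, heckeTn_one]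
  rfl

/-- **`T_{mn} = T_m T_n` on `S_k(Γ₀(N))` for coprime `m, n ≥ 1`.** [cite: DiamondShurman2005, §5.3 (5.10)] -/
theorem heckeTnGamma0_mul_of_coprime {m n : ℕ} (hm : m ≠ 0) (hn : n ≠ 0) (hmn : m.Coprime n) :
    heckeTnGamma0 N k (m * n) = heckeTnGamma0 N k m * heckeTnGamma0 N k n := by
  apply LinearMap.ext
  intro f
  apply liftToGamma1_injective N k
  rw [liftToGamma1_heckeTnGamma0, heckeTn_mul_of_coprime N k hm hn hmn, Module.End.mul_apply,
    Module.End.mul_apply, liftToGamma1_heckeTnGamma0, liftToGamma1_heckeTnGamma0]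

/-- **The Hecke recursion on `S_k(Γ₀(N))` at a prime `p ∤ N`**:
`T_{p^{a+2}} = T_p T_{p^{a+1}} - p^{k-1} T_{p^a}` (`⟨p⟩ = 1` on `S_k(N, 𝟙)`).
[cite: DiamondShurman2005, §5.3 (definition of T_{p^r})] -/
theorem heckeTnGamma0_prime_pow {p : ℕ} (hp : p.Prime) (hpN : ¬ p ∣ N) (a : ℕ) :
    heckeTnGamma0 N k (p ^ (a + 2)) =
      heckeTnGamma0 N k p * heckeTnGamma0 N k (p ^ (a + 1)) -
        (p : ℂ) ^ (k - 1) • heckeTnGamma0 N k (p ^ a) := by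
  haveI : NeZero p := ⟨hp.ne_zero⟩
  have hcop : p.Coprime N := (Nat.Prime.coprime_iff_not_dvd hp).mpr hpN
  apply LinearMap.ext
  intro f
  apply liftToGamma1_injective N k
  rw [liftToGamma1_heckeTnGamma0, MurtySinha.heckeTn_prime_pow N k p hp, MurtySinha.heckeTPrimePow_add_two,
    LinearMap.sub_apply, LinearMap.smul_apply, Module.End.mul_apply, Module.End.mul_apply,
    ← MurtySinha.heckeTn_prime_pow N k p hp, ← MurtySinha.heckeTn_prime_pow N k p hp,
    ← liftToGamma1_heckeTnGamma0, ← liftToGamma1_heckeTnGamma0,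
    diamondOrZero_apply_of_mem N k p (MurtySinha.liftToGamma1_mem_nebentypusSubspace_one N k _),
    if_pos hcop, heckeT_liftToGamma1, LinearMap.sub_apply, LinearMap.smul_apply, Module.End.mul_apply,
    map_sub, map_smul, heckeTnGamma0_prime N k p hp]

/-- **`tr (T_n | S_k(Γ₀(N))) = Tr(T_n | S_k(N, 𝟙)) = cuspidalHeckeTrace N k 𝟙 n`**, the
left-hand side of the Eichler–Selberg trace formula `HeckeTraceFormulaGL2Level N 1 k`.
[cite: DiamondShurman2005, §5.2 p. 169] -/
theorem trace_heckeTnGamma0 (n : ℕ) :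
    LinearMap.trace ℂ _ (heckeTnGamma0 N k n) = cuspidalHeckeTrace N k 1 n := by
  rw [cuspidalHeckeTrace, traceOn_eq_trace_restrict _ _ (heckeTn_mem_nebentypusSubspace_one N k n),
    heckeTnGamma0, LinearMap.trace_conj']

end Transport

/-! ### The Hecke family `T_n` on `S_k(Γ₀(N))` -/

section Family

/-- **The `T_n` on `S_k(Γ₀(N))` form a Hecke family away from `N`** with constants
`c(p) = p^{k-1}`. [cite: DiamondShurman2005, §5.3] -/
theorem isHeckeFamily_heckeTnGamma0 :
    IsHeckeFamily N (fun p => (p : ℂ) ^ (k - 1)) (heckeTnGamma0 N k) where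
  map_one := heckeTnGamma0_one N k
  map_mul_of_coprime {m n} hmn _ := by
    rcases Nat.eq_zero_or_pos m with rfl | hm
    · have hn1 : n = 1 := by simpa [Nat.coprime_zero_left] using hmn
      rw [hn1, mul_one, heckeTnGamma0_one, mul_one]
    rcases Nat.eq_zero_or_pos n with rfl | hn
    · have hm1 : m = 1 := by simpa [Nat.coprime_zero_right] using hmn
      rw [hm1, one_mul, heckeTnGamma0_one, one_mul]
    exact heckeTnGamma0_mul_of_coprime N k hm.ne' hn.ne' hmn
  map_prime_pow hq hqN a := heckeTnGamma0_prime_pow N k hq hqN a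

/-- **The `T_p`, `p ∤ N`, on `S_k(Γ₀(N))` are a semisimple commuting family**: they commute
(`heckeT_comm_gamma0_holds`) and each is diagonalisable, being self-adjoint for the Petersson
product (Diamond–Shurman Thm. 5.5.3–5.5.4; `heckeT_selfAdjoint_holds`,
`maxGenEigenspace_eq_eigenspace_of_selfAdjoint`). [cite: DiamondShurman2005, Thm. 5.5.4] -/
theorem isSemisimpleFamily_heckeTnGamma0 : IsSemisimpleFamily N (heckeTnGamma0 N k) := by
  haveI : FiniteDimensional ℂ (CuspForm (Gamma0 N) k) := finiteDimensional_cuspForm_gamma0 N k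
  refine IsSemisimpleFamily.of_maxGenEigenspace_eq (fun q q' => ?_) (fun q μ => ?_)
  · haveI : NeZero (q : ℕ) := ⟨q.2.1.ne_zero⟩
    haveI : NeZero (q' : ℕ) := ⟨q'.2.1.ne_zero⟩
    rw [heckeTnGamma0_prime N k q q.2.1, heckeTnGamma0_prime N k q' q'.2.1]
    exact heckeT_comm_gamma0_holds N k q q'
  · haveI : NeZero (q : ℕ) := ⟨q.2.1.ne_zero⟩
    rw [heckeTnGamma0_prime N k q q.2.1]
    exact maxGenEigenspace_eq_eigenspace_of_selfAdjoint
      (fun x y ↦ peterssonProduct (Gamma0 N) k x y)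
      (fun u v w ↦ peterssonProduct_add_right k u v w)
      (fun c v w ↦ peterssonProduct_smul_right (Gamma0 N) k c v w)
      (fun v w ↦ peterssonProduct_conj_symm_holds (Gamma0 N) k v w)
      (fun v hv ↦ eq_zero_of_peterssonProduct_self_eq_zero k v hv)
      _ (fun v w ↦ heckeT_selfAdjoint_holds N k q q.2.1 q.2.2 v w) μ

/-- The simultaneous eigenspaces of the family are the `T_p`-eigenpackets away from `N`:
`f ∈ eigenChar N T χ ↔ T_p f = χ(p) f` for all primes `p ∤ N`. [folklore] -/
theorem mem_eigenChar_heckeTnGamma0_iff (χ : PrimesNotDvd N → ℂ) (f : CuspForm (Gamma0 N) k) :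
    f ∈ eigenChar N (heckeTnGamma0 N k) χ ↔
      ∀ q : PrimesNotDvd N, (haveI : NeZero (q : ℕ) := ⟨q.2.1.ne_zero⟩; heckeT (Gamma0 N) k q f) = χ q • f := by
  rw [mem_eigenChar_iff]
  refine forall_congr' fun q => ?_
  haveI : NeZero (q : ℕ) := ⟨q.2.1.ne_zero⟩
  rw [heckeTnGamma0_prime N k q q.2.1]

end Family

end Literature.NumberTheory.EllipticCurves.ModularForms

end
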